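import Literature.Geometry.Riemannian.SurgicalRicciFlow
import Literature.Topology.FourManifolds.ConnectedSumSummands
import Mathlib.Topology.Homotopy.Lifting
import HarnessLib

/-!
# A simply connected space contains no open copy of the punctured real projective space

For `n ≥ 2` the model cap `ℝℙⁿ ∖ 𝔹̄ⁿ` of Chen–Zhu's canonical neighbourhoods
(`Literature.Geometry.Riemannian.puncturedRealProjectiveSpace n`, `CanonicalNeighbourhoods.lean`:
the complement in `ℝℙⁿ = 𝕊ⁿ/±1` of the image of the closed polar cap `{y₀ ≥ 1/2}`, i.e. the
image of the zone `{|y₀| < 1/2}`) admits **no open embedding into a simply connected Hausdorff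
space** (`not_simplyConnectedSpace_of_isOpenEmbedding_puncturedRealProjectiveSpace`). In the
deduction of Hamilton's Cor. 1.2(a) from the Ricci flow with surgery as vended structurally
(`Literature.Geometry.Riemannian.IsSurgeryStep`, `SurgicalRicciFlow.lean`, whose pre-surgery pieces
(iii) include collared projective caps `IsProjectiveCapPiece`, Chen–Zhu 2006, Thm. 1.1 (iii) and
§4 p. 24: `ε`-caps of type `ℝℙ⁴ ∖ 𝔹̄⁴`), this is the observation that such caps do not occur in a
simply connected component — Hamilton 1997, p. 2 / Chen–Tang–Zhu 2012, p. 3: for `π₁ = 1` no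
`ℝℙ⁴` summands arise.

## The proof (elementary covering-space argument, no van Kampen)

Let `ι : ℝℙⁿ ∖ 𝔹̄ⁿ ↪ S` be an open embedding into a simply connected Hausdorff `S`.
* **Pinch.** The odd continuous self-map `T y = v(y)/‖v(y)‖`, `v(y) = y₀ e₀ + λ(y₀)(y - y₀ e₀)`
  with `λ = 1` on `|y₀| ≤ 1/4` and `λ = 0` on `|y₀| ≥ 1/2`, descends to `π̄ : ℝℙⁿ → ℝℙⁿ`, the
  identity on the low zone `{|y₀| ≤ 1/4}` and constant (the pole) on the closed cap
  `{|y₀| ≥ 1/2} = ℝℙⁿ ∖ (ℝℙⁿ ∖ 𝔹̄ⁿ)`. The map `c : S → ℝℙⁿ`, `c (ι p) = π̄ p`, `c = pole` off the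
  image, is continuous: off `range ι` it is locally constant up to the compact sets
  `ι {π̄ ∉ V}` (`continuous_pinchExtend`).
* **Loop.** The half great circle `γ̃ s = cos(πs) e₁ + sin(πs) e₂` of the equator `{y₀ = 0}`
  from `e₁` to `-e₁` projects to a loop `γ` of `ℝℙⁿ` inside the low zone; `ι ∘ γ` is a loop of
  `S`, null-homotopic as `S` is simply connected, and applying `c` (which restricts to the
  identity along `γ`) shows `γ` null-homotopic in `ℝℙⁿ`.
* **Monodromy.** `𝕊ⁿ → ℝℙⁿ` is a covering map (`IsRealProjectiveSpace.isCoveringMap`); the lift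
  of `γ` at `e₁` is `γ̃`, ending at `-e₁ ≠ e₁`, while homotopic loops have lifts with equal
  endpoints (`IsCoveringMap.liftPath_apply_one_eq_of_homotopicRel`) — contradiction
  (Hatcher, *Algebraic Topology*, Prop. 1.30 and Example 1.43).

## References

* A. Hatcher, *Algebraic Topology*, CUP (2002), Prop. 1.30 (homotopy lifting), Example 1.43
  (`ℝℙⁿ`). [HatcherAT2002]
* B.-L. Chen, X.-P. Zhu, *Ricci flow with surgery on four-manifolds with positive isotropic
  curvature*, J. Differential Geom. 74 (2006), Thm. 1.1 (iii), §4 p. 24. [ChenZhu2006]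
* R. S. Hamilton, *Four-manifolds with positive isotropic curvature*, Comm. Anal. Geom. 5 (1997),
  Thm. 1.1 and p. 2. [Hamilton1997]
-/

noncomputable section

open Set Function Metric Topology unitInterval
open scoped Manifold ContDiff Topology Real

namespace Literature.Geometry.Riemannian

open Literature.Topology.FourManifolds Literature.Topology.FourManifolds.RealProjectiveSpace

/-- Local notation: `𝔼 n` is the model Euclidean space `EuclideanSpace ℝ (Fin n)`. -/
local notation "𝔼 " n:arg => EuclideanSpace ℝ (Fin n)

/-- Local notation: the standard unit `n`-sphere `𝕊 n ⊂ ℝⁿ⁺¹`. -/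
local notation "𝕊 " n:arg => (Metric.sphere (0 : EuclideanSpace ℝ (Fin (n + 1))) 1)

namespace ProjectiveCap

variable {n : ℕ}

/-! ### Functions on `ℝℙⁿ` from even functions on `𝕊ⁿ`, self-maps from odd self-maps -/

/-- A chosen representative `𝕊ⁿ → ℝℙⁿ → 𝕊ⁿ` of a point of `ℝℙⁿ`. [folklore] -/
def rep (p : RealProjectiveSpace n) : 𝕊 n := (mk_surjective n p).choose

/-- The representative represents. [folklore] -/
theorem mk_rep (p : RealProjectiveSpace n) : mk n (rep p) = p := (mk_surjective n p).choose_spec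

/-- The representative of `mk y` is `y` or `-y`. [folklore] -/
theorem rep_mk (y : 𝕊 n) : rep (mk n y) = y ∨ rep (mk n y) = -y :=
  (mk_eq_mk_iff y (rep (mk n y))).1 (mk_rep (mk n y)).symm

/-- **Descent of an even function**: `f̄ (mk y) = f y` for `f (-y) = f y`. [folklore] -/
def liftEven {α : Type*} (f : (𝕊 n) → α) (p : RealProjectiveSpace n) : α := f (rep p)

/-- The descended even function on representatives. [folklore] -/
theorem liftEven_mk {α : Type*} {f : (𝕊 n) → α} (hf : ∀ y, f (-y) = f y) (y : 𝕊 n) :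
    liftEven f (mk n y) = f y := by
  unfold liftEven
  rcases rep_mk y with h | h
  · rw [h]
  · rw [h, hf]

/-- The projection `𝕊ⁿ → ℝℙⁿ` is a quotient map (a continuous open surjection). [folklore] -/
theorem isQuotientMap_mk (n : ℕ) : IsQuotientMap (mk n) :=
  (isLocalDiffeomorph_mk n).isOpenMap.isQuotientMap (contMDiff_mk n).continuous (mk_surjective n)

/-- A descended even continuous function is continuous. [folklore] -/
theorem continuous_liftEven {α : Type*} [TopologicalSpace α] {f : (𝕊 n) → α}
    (hf : ∀ y, f (-y) = f y) (hfc : Continuous f) : Continuous (liftEven f) := by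
  rw [(isQuotientMap_mk n).continuous_iff]
  have : liftEven f ∘ mk n = f := funext fun y => liftEven_mk hf y
  rw [this]
  exact hfc

/-- **Descent of an odd self-map** of the sphere to a self-map of `ℝℙⁿ`. [folklore] -/
def descend (T : (𝕊 n) → 𝕊 n) (p : RealProjectiveSpace n) : RealProjectiveSpace n := mk n (T (rep p))

/-- The descended odd map on representatives: `T̄ (mk y) = mk (T y)`. [folklore] -/
theorem descend_mk {T : (𝕊 n) → 𝕊 n} (hT : ∀ y, T (-y) = -T y) (y : 𝕊 n) :
    descend T (mk n y) = mk n (T y) := by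
  unfold descend
  rcases rep_mk y with h | h
  · rw [h]
  · rw [h, hT, mk_eq_mk_iff]
    exact Or.inr (neg_neg _).symm

/-- A descended odd continuous self-map is continuous. [folklore] -/
theorem continuous_descend {T : (𝕊 n) → 𝕊 n} (hT : ∀ y, T (-y) = -T y) (hTc : Continuous T) :
    Continuous (descend T) := by
  rw [(isQuotientMap_mk n).continuous_iff]
  have : descend T ∘ mk n = mk n ∘ T := funext fun y => descend_mk hT y
  rw [this]
  exact (contMDiff_mk n).continuous.comp hTc

/-! ### The height `|y₀|` and the punctured projective space -/

/-- The height `|y₀|` of a point of `ℝℙⁿ` (well defined: `|(-y)₀| = |y₀|`). [folklore] -/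
def height : RealProjectiveSpace n → ℝ := liftEven fun y : 𝕊 n => |(y : 𝔼 (n + 1)) 0|

/-- The height of `mk y` is `|y₀|`. [folklore] -/
theorem height_mk (y : 𝕊 n) : height (mk n y) = |(y : 𝔼 (n + 1)) 0| :=
  liftEven_mk (fun y => by simp [coe_neg_sphere]) y

/-- The height is continuous. [folklore] -/
theorem continuous_height : Continuous (height : RealProjectiveSpace n → ℝ) :=
  continuous_liftEven (fun y => by simp [coe_neg_sphere])
    (continuous_abs.comp ((EuclideanSpace.proj (0 : Fin (n + 1))).continuous.comp
      continuous_subtype_val))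

/-- **The punctured projective space is the low zone** `{|y₀| < 1/2}` of `ℝℙⁿ`. [folklore] -/
theorem mem_puncturedRealProjectiveSpace_iff_height (p : RealProjectiveSpace n) :
    p ∈ puncturedRealProjectiveSpace n ↔ height p < 1 / 2 := by
  obtain ⟨y, rfl⟩ := mk_surjective n p
  rw [mem_puncturedRealProjectiveSpace, height_mk]
  constructor
  · intro h
    rw [abs_lt]
    constructor
    · by_contra h'
      rw [not_lt] at h'
      refine h (-y) ?_ ((mk_eq_mk_iff _ _).2 (Or.inr (neg_neg y).symm))
      change (1 / 2 : ℝ) ≤ ((-y : 𝕊 n) : 𝔼 (n + 1)) 0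
      rw [coe_neg_sphere]
      simp only [PiLp.neg_apply]
      linarith
    · by_contra h'
      rw [not_lt] at h'
      exact h y h' rfl
  · intro h y' hy' heq
    rw [mk_eq_mk_iff] at heq
    change (1 / 2 : ℝ) ≤ (y' : 𝔼 (n + 1)) 0 at hy'
    rcases heq with rfl | rfl
    · exact (abs_lt.1 h).2.not_ge hy'
    · rw [coe_neg_sphere] at h
      simp only [PiLp.neg_apply, abs_neg] at h
      exact (abs_lt.1 h).2.not_ge hy'

/-! ### The pinch `T` of the sphere and its descent `π̄` -/

/-- The weight `λ(u) = max 0 (min 1 (2 - 4|u|))`: `1` on `|u| ≤ 1/4`, `0` on `|u| ≥ 1/2`.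
[folklore] -/
def weight (u : ℝ) : ℝ := max 0 (min 1 (2 - 4 * |u|))

/-- The weight is `1` on `|u| ≤ 1/4`. [folklore] -/
theorem weight_of_le {u : ℝ} (h : |u| ≤ 1 / 4) : weight u = 1 := by
  unfold weight
  rw [min_eq_left (by linarith), max_eq_right zero_le_one]

/-- The weight is `0` on `|u| ≥ 1/2`. [folklore] -/
theorem weight_of_ge {u : ℝ} (h : 1 / 2 ≤ |u|) : weight u = 0 := by
  unfold weight
  rw [max_eq_left]
  exact min_le_of_right_le (by linarith)

/-- The weight is even. [folklore] -/
theorem weight_neg (u : ℝ) : weight (-u) = weight u := by simp [weight]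

/-- The weight is continuous. [folklore] -/
theorem continuous_weight : Continuous weight :=
  continuous_const.max (continuous_const.min (continuous_const.sub (continuous_const.mul continuous_abs)))

/-- The pole vector `e₀`. [folklore] -/
def e0 : 𝔼 (n + 1) := EuclideanSpace.single 0 1

/-- The pinch on vectors: `v(y) = y₀ e₀ + λ(y₀) (y - y₀ e₀)`. [folklore] -/
def pinchVec (y : 𝔼 (n + 1)) : 𝔼 (n + 1) := y 0 • e0 + weight (y 0) • (y - y 0 • e0)

/-- The pinch preserves the height coordinate `y₀`. [folklore] -/
theorem pinchVec_apply_zero (y : 𝔼 (n + 1)) : pinchVec y 0 = y 0 := by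
  simp [pinchVec, e0]

/-- The pinch on vectors is odd. [folklore] -/
theorem pinchVec_neg (y : 𝔼 (n + 1)) : pinchVec (-y) = -pinchVec y := by
  rw [pinchVec, pinchVec, PiLp.neg_apply, weight_neg]
  module

/-- The pinch on vectors is continuous. [folklore] -/
theorem continuous_pinchVec : Continuous (pinchVec : 𝔼 (n + 1) → 𝔼 (n + 1)) := by
  have h0 : Continuous fun y : 𝔼 (n + 1) => y 0 := (EuclideanSpace.proj (0 : Fin (n + 1))).continuous
  unfold pinchVec
  exact (h0.smul continuous_const).add
    ((continuous_weight.comp h0).smul (continuous_id.sub (h0.smul continuous_const)))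

/-- On the low zone the pinch is the identity. [folklore] -/
theorem pinchVec_of_le {y : 𝔼 (n + 1)} (h : |y 0| ≤ 1 / 4) : pinchVec y = y := by
  rw [pinchVec, weight_of_le h, one_smul, add_sub_cancel]

/-- On the caps the pinch is `y₀ e₀`. [folklore] -/
theorem pinchVec_of_ge {y : 𝔼 (n + 1)} (h : 1 / 2 ≤ |y 0|) : pinchVec y = y 0 • e0 := by
  rw [pinchVec, weight_of_ge h, zero_smul, add_zero]

/-- The pinch of a unit vector is nonzero. [folklore] -/
theorem pinchVec_ne_zero (y : 𝕊 n) : pinchVec (y : 𝔼 (n + 1)) ≠ 0 := by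
  intro h
  have h0 : (y : 𝔼 (n + 1)) 0 = 0 := by rw [← pinchVec_apply_zero (y : 𝔼 (n + 1)), h]; rfl
  have : pinchVec (y : 𝔼 (n + 1)) = y := pinchVec_of_le (by rw [h0, abs_zero]; norm_num)
  rw [this] at h
  exact ne_zero_of_mem_unit_sphere y h

/-- **The pinch** `T y = v(y)/‖v(y)‖` of the sphere. [folklore] -/
def pinch (y : 𝕊 n) : 𝕊 n :=
  ⟨‖pinchVec (y : 𝔼 (n + 1))‖⁻¹ • pinchVec (y : 𝔼 (n + 1)), by
    rw [mem_sphere_zero_iff_norm, norm_smul, norm_inv, norm_norm,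
      inv_mul_cancel₀ (norm_ne_zero_iff.2 (pinchVec_ne_zero y))]⟩

/-- The pinch on underlying vectors. [folklore] -/
theorem coe_pinch (y : 𝕊 n) :
    (pinch y : 𝔼 (n + 1)) = ‖pinchVec (y : 𝔼 (n + 1))‖⁻¹ • pinchVec (y : 𝔼 (n + 1)) := rfl

/-- The pinch is odd. [folklore] -/
theorem pinch_neg (y : 𝕊 n) : pinch (-y) = -pinch y := by
  apply Subtype.ext
  rw [coe_neg_sphere, coe_pinch, coe_pinch, coe_neg_sphere, pinchVec_neg, norm_neg, smul_neg]

/-- The pinch is continuous. [folklore] -/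
theorem continuous_pinch : Continuous (pinch : (𝕊 n) → 𝕊 n) := by
  apply Continuous.subtype_mk
  have hv : Continuous fun y : 𝕊 n => pinchVec (y : 𝔼 (n + 1)) :=
    continuous_pinchVec.comp continuous_subtype_val
  exact ((hv.norm).inv₀ fun y => norm_ne_zero_iff.2 (pinchVec_ne_zero y)).smul hv

/-- On the low zone `|y₀| ≤ 1/4` the pinch is the identity. [folklore] -/
theorem pinch_of_le {y : 𝕊 n} (h : |(y : 𝔼 (n + 1)) 0| ≤ 1 / 4) : pinch y = y := by
  apply Subtype.ext
  rw [coe_pinch, pinchVec_of_le h, norm_eq_of_mem_sphere, inv_one, one_smul]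

/-- The pole `e₀ ∈ 𝕊ⁿ`. [folklore] -/
def pole : 𝕊 n := ⟨e0, by simp [e0]⟩

/-- On the caps `|y₀| ≥ 1/2` the pinch is `± e₀`, i.e. the pole of `ℝℙⁿ`. [folklore] -/
theorem mk_pinch_of_ge {y : 𝕊 n} (h : 1 / 2 ≤ |(y : 𝔼 (n + 1)) 0|) :
    mk n (pinch y) = mk n pole := by
  have hy0 : (y : 𝔼 (n + 1)) 0 ≠ 0 := fun h0 => by rw [h0, abs_zero] at h; norm_num at h
  have hnorm : ‖((y : 𝔼 (n + 1)) 0) • (e0 : 𝔼 (n + 1))‖ = |(y : 𝔼 (n + 1)) 0| := by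
    rw [norm_smul, Real.norm_eq_abs]
    simp [e0]
  have hcoe : (pinch y : 𝔼 (n + 1)) = (|(y : 𝔼 (n + 1)) 0|⁻¹ * (y : 𝔼 (n + 1)) 0) • e0 := by
    rw [coe_pinch, pinchVec_of_ge h, hnorm, smul_smul]
  rw [mk_eq_mk_iff]
  rcases lt_or_gt_of_ne hy0 with hneg | hpos
  · right
    apply Subtype.ext
    rw [coe_neg_sphere, hcoe, abs_of_neg hneg]
    change (e0 : 𝔼 (n + 1)) = -(((-(y : 𝔼 (n + 1)) 0)⁻¹ * (y : 𝔼 (n + 1)) 0) • e0)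
    rw [← neg_smul, neg_mul_eq_neg_mul, neg_inv, neg_neg, inv_mul_cancel₀ hy0, one_smul]
  · left
    apply Subtype.ext
    rw [hcoe, abs_of_pos hpos, inv_mul_cancel₀ hy0, one_smul]
    rfl

/-- **The descended pinch** `π̄ : ℝℙⁿ → ℝℙⁿ`. [folklore] -/
def pinchRP : RealProjectiveSpace n → RealProjectiveSpace n := descend pinch

/-- The descended pinch on representatives. [folklore] -/
theorem pinchRP_mk (y : 𝕊 n) : pinchRP (mk n y) = mk n (pinch y) := descend_mk pinch_neg y

/-- The descended pinch is continuous. [folklore] -/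
theorem continuous_pinchRP : Continuous (pinchRP : RealProjectiveSpace n → RealProjectiveSpace n) :=
  continuous_descend pinch_neg continuous_pinch

/-- Off the punctured projective space the descended pinch is the pole. [folklore] -/
theorem pinchRP_of_not_mem {p : RealProjectiveSpace n} (hp : p ∉ puncturedRealProjectiveSpace n) :
    pinchRP p = mk n pole := by
  obtain ⟨y, rfl⟩ := mk_surjective n p
  rw [mem_puncturedRealProjectiveSpace_iff_height, height_mk, not_lt] at hp
  rw [pinchRP_mk, mk_pinch_of_ge hp]

/-- On the low zone the descended pinch is the identity. [folklore] -/
theorem pinchRP_mk_of_le {y : 𝕊 n} (h : |(y : 𝔼 (n + 1)) 0| ≤ 1 / 4) :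
    pinchRP (mk n y) = mk n y := by
  rw [pinchRP_mk, pinch_of_le h]

/-! ### Extending the pinch over a space containing the punctured projective space -/

section Extend

variable {S : Type*} {ι : puncturedRealProjectiveSpace n → S}

/-- **The pinch extended to `S`**: `c (ι p) = π̄ p` on the image of the open embedding
`ι : ℝℙⁿ ∖ 𝔹̄ⁿ ↪ S`, and the pole elsewhere. [folklore] -/
def pinchExtend (ι : puncturedRealProjectiveSpace n → S) : S → RealProjectiveSpace n :=
  Function.extend ι (fun p : puncturedRealProjectiveSpace n => pinchRP (p : RealProjectiveSpace n))
    fun _ => mk n pole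

/-- The extended pinch on the image of `ι`. [folklore] -/
theorem pinchExtend_apply (hι : Injective ι) (p : puncturedRealProjectiveSpace n) :
    pinchExtend ι (ι p) = pinchRP (p : RealProjectiveSpace n) :=
  hι.extend_apply _ _ p

/-- The extended pinch off the image of `ι` is the pole. [folklore] -/
theorem pinchExtend_of_not_mem {s : S} (hs : s ∉ range ι) : pinchExtend ι s = mk n pole := by
  rw [pinchExtend, extend_apply']
  rintro ⟨p, rfl⟩
  exact hs (mem_range_self p)

variable [TopologicalSpace S]

/-- **The extended pinch is continuous** (for `ι` an open embedding into a Hausdorff space): on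
the image it is `π̄ ∘ ι⁻¹`; at a point off the image, for every neighbourhood `V` of the pole
the compact set `ι {p | π̄ p ∉ V}` (compact because `{π̄ ∉ V}` is closed in `ℝℙⁿ` and misses the
closed cap, where `π̄` is the pole) is closed and avoids the point, and `c ∈ V` off it.
[folklore] -/
theorem continuous_pinchExtend [T2Space S] (hι : IsOpenEmbedding ι) : Continuous (pinchExtend ι) := by
  rw [continuous_iff_continuousAt]
  intro s
  by_cases hs : s ∈ range ι
  · obtain ⟨p, rfl⟩ := hs
    rw [← hι.continuousAt_iff]
    have : pinchExtend ι ∘ ι = fun p : puncturedRealProjectiveSpace n =>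
        pinchRP (p : RealProjectiveSpace n) :=
      funext fun p => pinchExtend_apply hι.injective p
    rw [this]
    exact (continuous_pinchRP.comp continuous_subtype_val).continuousAt
  · rw [ContinuousAt, pinchExtend_of_not_mem hs, Filter.tendsto_def]
    intro V hV
    obtain ⟨V', hV'V, hV'o, hpV'⟩ := mem_nhds_iff.1 hV
    -- the bad set `L = {p | π̄ p ∉ V'}`, closed in `ℝℙⁿ`, contained in the punctured space
    set L : Set (RealProjectiveSpace n) := {p | pinchRP p ∉ V'} with hL
    have hLc : IsClosed L := by
      have : L = pinchRP ⁻¹' V'ᶜ := rfl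
      rw [this]
      exact hV'o.isClosed_compl.preimage continuous_pinchRP
    have hLK : IsCompact L := hLc.isCompact
    have hLP : L ⊆ (puncturedRealProjectiveSpace n : Set (RealProjectiveSpace n)) := by
      intro p hp
      by_contra hpP
      exact hp (by rw [pinchRP_of_not_mem hpP]; exact hpV')
    -- as a subset of the subtype it is compact
    set L' : Set (puncturedRealProjectiveSpace n) := Subtype.val ⁻¹' L with hL'
    have hL'K : IsCompact L' := by
      rw [Subtype.isCompact_iff]
      have : (Subtype.val '' L' : Set (RealProjectiveSpace n)) = L := by
        rw [hL', image_preimage_eq_inter_range, Subtype.range_coe, inter_eq_left.2 hLP]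
      rw [this]
      exact hLK
    have hclosed : IsClosed (ι '' L') := (hL'K.image hι.continuous).isClosed
    have hsmem : s ∉ ι '' L' := fun ⟨p, _, hp⟩ => hs ⟨p, hp⟩
    filter_upwards [hclosed.isOpen_compl.mem_nhds hsmem] with t ht
    rw [mem_preimage]
    by_cases htr : t ∈ range ι
    · obtain ⟨p, rfl⟩ := htr
      rw [pinchExtend_apply hι.injective]
      apply hV'V
      by_contra hpV
      exact ht ⟨p, hpV, rfl⟩
    · rw [pinchExtend_of_not_mem htr]
      exact mem_of_mem_nhds hV

end Extend

/-! ### The equatorial half great circle -/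

section Loop

variable (n) in
/-- The index `1 : Fin (n + 1)` (for `n ≥ 2`). [folklore] -/
def i1 (hn : 2 ≤ n) : Fin (n + 1) := ⟨1, by omega⟩

variable (n) in
/-- The index `2 : Fin (n + 1)` (for `n ≥ 2`). [folklore] -/
def i2 (hn : 2 ≤ n) : Fin (n + 1) := ⟨2, by omega⟩

variable (hn : 2 ≤ n)

/-- The half great circle `γ̃ s = cos(πs) e₁ + sin(πs) e₂` on vectors. [folklore] -/
def arcVec (s : ℝ) : 𝔼 (n + 1) :=
  Real.cos (π * s) • EuclideanSpace.single (i1 n hn) 1 +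
    Real.sin (π * s) • EuclideanSpace.single (i2 n hn) 1

/-- The half great circle is continuous. [folklore] -/
theorem continuous_arcVec : Continuous (arcVec hn) := by
  unfold arcVec
  fun_prop

/-- The half great circle lies on the unit sphere (`e₁ ⊥ e₂` unit vectors). [folklore] -/
theorem norm_arcVec (s : ℝ) : ‖arcVec hn s‖ = 1 := by
  have h12 : i1 n hn ≠ i2 n hn := by simp [i1, i2, Fin.ext_iff]
  have hsq : ‖arcVec hn s‖ ^ 2 = 1 := by
    rw [arcVec, norm_add_sq_real, norm_smul, norm_smul, real_inner_smul_left, real_inner_smul_right,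
      EuclideanSpace.inner_single_left]
    simp only [PiLp.norm_single, Real.norm_eq_abs, map_one, norm_one, mul_one,
      PiLp.single_apply, if_neg h12, mul_zero, sq_abs, add_zero]
    exact Real.cos_sq_add_sin_sq (π * s)
  have h0 : 0 ≤ ‖arcVec hn s‖ := norm_nonneg _
  nlinarith [hsq, h0]

/-- The half great circle lies in the equator `y₀ = 0`. [folklore] -/
theorem arcVec_apply_zero (s : ℝ) : arcVec hn s 0 = 0 := by
  have h1 : (0 : Fin (n + 1)) ≠ i1 n hn := by simp [i1, Fin.ext_iff]
  have h2 : (0 : Fin (n + 1)) ≠ i2 n hn := by simp [i2, Fin.ext_iff]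
  simp [arcVec, h1, h2]

/-- The point `e₁ ∈ 𝕊ⁿ`. [folklore] -/
def e1 : 𝕊 n := ⟨EuclideanSpace.single (i1 n hn) 1, by simp [PiLp.norm_single]⟩

/-- The half great circle starts at `e₁`. [folklore] -/
theorem arcVec_zero : arcVec hn 0 = (e1 hn : 𝔼 (n + 1)) := by
  simp [arcVec, e1]

/-- The half great circle ends at `-e₁`. [folklore] -/
theorem arcVec_one : arcVec hn 1 = -(e1 hn : 𝔼 (n + 1)) := by
  simp [arcVec, e1]

/-- The half great circle as a path of the sphere from `e₁` to `-e₁`. [folklore] -/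
def arc : Path (e1 hn) (-e1 hn) where
  toFun s := ⟨arcVec hn s, mem_sphere_zero_iff_norm.2 (norm_arcVec hn s)⟩
  continuous_toFun := (continuous_arcVec hn).comp continuous_subtype_val |>.subtype_mk _
  source' := Subtype.ext (by simp [arcVec_zero])
  target' := Subtype.ext (by rw [coe_neg_sphere]; simp [arcVec_one])

/-- The arc on underlying vectors. [folklore] -/
theorem coe_arc (s : I) : ((arc hn s : 𝕊 n) : 𝔼 (n + 1)) = arcVec hn s := rfl

/-- The arc lies in the equator. [folklore] -/
theorem arc_apply_zero_coord (s : I) : ((arc hn s : 𝕊 n) : 𝔼 (n + 1)) 0 = 0 := by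
  rw [coe_arc, arcVec_apply_zero]

/-- The projected arc is a loop of `ℝℙⁿ` at the image of `e₁` (`mk (-e₁) = mk e₁`). [folklore] -/
def loopRP : Path (mk n (e1 hn)) (mk n (e1 hn)) where
  toFun s := mk n (arc hn s)
  continuous_toFun := (contMDiff_mk n).continuous.comp (arc hn).continuous
  source' := by rw [(arc hn).source]
  target' := by
    rw [(arc hn).target, mk_eq_mk_iff]
    exact Or.inr (neg_neg _).symm

/-- The projected loop pointwise. [folklore] -/
theorem loopRP_apply (s : I) : loopRP hn s = mk n (arc hn s) := rfl

/-- The loop lies in the punctured projective space (height `0`). [folklore] -/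
theorem loopRP_mem (s : I) : loopRP hn s ∈ puncturedRealProjectiveSpace n := by
  rw [loopRP_apply, mem_puncturedRealProjectiveSpace_iff_height, height_mk, arc_apply_zero_coord,
    abs_zero]
  norm_num

/-- The descended pinch fixes the loop pointwise. [folklore] -/
theorem pinchRP_loopRP (s : I) : pinchRP (loopRP hn s) = loopRP hn s := by
  rw [loopRP_apply, pinchRP_mk_of_le]
  rw [arc_apply_zero_coord, abs_zero]
  norm_num

/-- **The projected half great circle is not null-homotopic in `ℝℙⁿ`** (monodromy of the
covering `𝕊ⁿ → ℝℙⁿ`: its lift at `e₁` ends at `-e₁ ≠ e₁`; Hatcher, Prop. 1.30, Example 1.43).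
[cite: HatcherAT2002, Prop. 1.30 and Example 1.43] -/
theorem not_homotopic_loopRP_refl : ¬ (loopRP hn).Homotopic (Path.refl (mk n (e1 hn))) := by
  intro hhom
  have cov : IsCoveringMap (mk n) :=
    IsRealProjectiveSpace.isCoveringMap (isLocalDiffeomorph_mk n) (mk_surjective n) mk_eq_mk_iff
  have h₀ : (loopRP hn).toContinuousMap 0 = mk n (e1 hn) := (loopRP hn).source
  have h₁ : (Path.refl (mk n (e1 hn))).toContinuousMap 0 = mk n (e1 hn) := rfl
  have hend := cov.liftPath_apply_one_eq_of_homotopicRel hhom (e1 hn) h₀ h₁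
  -- the lift of the loop is the arc
  have hlift1 : (arc hn).toContinuousMap = cov.liftPath (loopRP hn).toContinuousMap (e1 hn) h₀ := by
    rw [cov.eq_liftPath_iff']
    exact ⟨rfl, (arc hn).source⟩
  -- the lift of the constant loop is constant
  have hlift2 : ContinuousMap.const I (e1 hn) =
      cov.liftPath (Path.refl (mk n (e1 hn))).toContinuousMap (e1 hn) h₁ := by
    rw [cov.eq_liftPath_iff']
    exact ⟨rfl, rfl⟩
  rw [← hlift1, ← hlift2] at hend
  have hend' : (arc hn).toContinuousMap 1 = e1 hn := hend
  rw [show (arc hn).toContinuousMap 1 = -e1 hn from (arc hn).target] at hend'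
  -- `-e₁ = e₁` forces `e₁ = 0`
  have hcoe : -((e1 hn : 𝕊 n) : 𝔼 (n + 1)) = (e1 hn : 𝔼 (n + 1)) := by
    rw [← coe_neg_sphere, hend']
  have hzero : ((e1 hn : 𝕊 n) : 𝔼 (n + 1)) = 0 := by
    have h2 : (2 : ℝ) • ((e1 hn : 𝕊 n) : 𝔼 (n + 1)) = 0 := by
      rw [two_smul]
      nth_rewrite 1 [← hcoe]
      exact neg_add_cancel _
    exact (smul_eq_zero.1 h2).resolve_left two_ne_zero
  exact ne_zero_of_mem_unit_sphere (e1 hn) hzero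

end Loop

end ProjectiveCap

open ProjectiveCap in
/-- **A simply connected Hausdorff space contains no open copy of `ℝℙⁿ ∖ 𝔹̄ⁿ`** (`n ≥ 2`): if
`ι : puncturedRealProjectiveSpace n ↪ S` is an open embedding into a Hausdorff space `S`, then
`S` is not simply connected. Proof: the loop `ι ∘ γ`, `γ` the projection of the equatorial half
great circle from `e₁` to `-e₁`, would be null-homotopic in `S`; composing the null-homotopy
with the continuous pinch `c : S → ℝℙⁿ` (`pinchExtend`: `π̄ ∘ ι⁻¹` on the image, the pole
elsewhere), which restricts to the identity along `γ`, makes `γ` null-homotopic in `ℝℙⁿ`, which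
it is not (`not_homotopic_loopRP_refl`, monodromy of `𝕊ⁿ → ℝℙⁿ`). This is why collared
projective caps (`IsProjectiveCapPiece`, Chen–Zhu 2006 Thm. 1.1 (iii)) do not occur in simply
connected components of the Ricci flow with surgery (Hamilton 1997, p. 2).
[cite: HatcherAT2002, Prop. 1.30 and Example 1.43] [cite: ChenZhu2006, Thm. 1.1 (iii) (p. 3)] -/
theorem not_simplyConnectedSpace_of_isOpenEmbedding_puncturedRealProjectiveSpace {n : ℕ}
    (hn : 2 ≤ n) {S : Type*} [TopologicalSpace S] [T2Space S]
    {ι : puncturedRealProjectiveSpace n → S} (hι : IsOpenEmbedding ι) : ¬ SimplyConnectedSpace S := by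
  intro hS
  -- the loop in the punctured space and its image in `S`
  let a : puncturedRealProjectiveSpace n := ⟨mk n (e1 hn), by simpa using loopRP_mem hn 0⟩
  let γP : Path a a :=
    { toFun := fun s => ⟨loopRP hn s, loopRP_mem hn s⟩
      continuous_toFun := (loopRP hn).continuous.subtype_mk _
      source' := Subtype.ext (loopRP hn).source
      target' := Subtype.ext (loopRP hn).target }
  let δ : Path (ι a) (ι a) := γP.map hι.continuous
  have hδ : δ.Homotopic (Path.refl (ι a)) := SimplyConnectedSpace.paths_homotopic _ _
  -- push the null-homotopy to `ℝℙⁿ` by the pinch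
  have hγ : (loopRP hn).Homotopic (Path.refl (mk n (e1 hn))) := by
    refine Path.Homotopic.refl_of_comp_eq δ hδ ⟨pinchExtend ι, continuous_pinchExtend hι⟩
      (loopRP hn) fun s => ?_
    change pinchExtend ι (ι (γP s)) = loopRP hn s
    rw [pinchExtend_apply hι.injective]
    exact pinchRP_loopRP hn s
  exact not_homotopic_loopRP_refl hn hγ

/-- **Collared projective cap pieces do not occur in simply connected manifolds**: if `C` is a
(collared) projective cap piece of the Hausdorff 4-manifold `M` relative to `N`
(`IsProjectiveCapPiece N C`: the image of `ℝℙ⁴` minus a closed cap under a smooth open embedding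
of `puncturedRealProjectiveSpace 4`), then `M` is not simply connected.
[cite: ChenZhu2006, Thm. 1.1 (iii) (p. 3) and §4, p. 24] -/
theorem IsProjectiveCapPiece.not_simplyConnectedSpace {M : Type} [TopologicalSpace M] [T2Space M]
    [ChartedSpace (𝔼 4) M] {N C : Set M} (h : IsProjectiveCapPiece N C) : ¬ SimplyConnectedSpace M := by
  obtain ⟨ι, hι, hopen, -, -⟩ := h
  exact not_simplyConnectedSpace_of_isOpenEmbedding_puncturedRealProjectiveSpace (by norm_num)
    ⟨hι.isEmbedding, hopen⟩

end Literature.Geometry.Riemannian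

end
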